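import Summits.KontsevichZagierPeriods.KontsevichZagierPeriods.Theorems.LinRedNormalFormArrangementNormalFormSeparateThreeHHKSecIIIa
import Summits.KontsevichZagierPeriods.KontsevichZagierPeriods.Theorems.LinRedNormalFormArrangementNormalFormSeparateThreeHHKSecIIIb
import Summits.KontsevichZagierPeriods.KontsevichZagierPeriods.Theorems.LinRedNormalFormArrangementNormalFormSeparateThreeHHKCoverB

/-!
# Local finiteness of the density of the Taylor pieces at every base point

(Line `janus-bands`, crux `ArrangementNormalForm`, stub `stub_separateHigh`, part `HHKLocal` of
the wall-invariant termwise-split lemma `separateThree_hHk` in base dimension `3` with fibres.)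
Every point `z₁` of the closure of the base polyhedron `Y ⊆ ℝ³` has an open neighbourhood on
which the density `g = 𝟙_Y (∑_{i<N} |Ri i|) m` of the Taylor pieces against the fibre mass has
finite integral (`local_finite3`, registered as `separateThreeHHK_local`). By the direction cover
of parts `HHKCover`, `HHKCoverB` (for the measure `g · vol`) it suffices to bound, for every unit
direction `d`, all nested sectors in a suitable frame plane; this is the case analysis of the
sector theorems: regular points (`SepHHK.sector_away`); at a pole point, directions transversal
to the pole plane on no active letter plane (`SepHHK.sector_typeI`) or on one
(`SepHHK.sector_null`, by the wall invariant), and directions in the pole plane with the adapted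
frame plane (`SepHHK.sector_IIIvert`, `SepHHK.sector_IIIgen`, `SepHHK.sector_IIIzero`).
-/

noncomputable section

open Set MeasureTheory Filter Topology
open scoped ENNReal

namespace Summit.KontsevichZagierPeriods.ArrangementNormalForm.JanusBands

namespace SepHHK

open SepTwo

/-! ### Frames -/

/-- Scaling the frame scales the determinant. -/
theorem det3_smul_smul (d Q S : Fin 3 → ℝ) (p q : ℝ) :
    det3 d (p • Q) (q • S) = p * q * det3 d Q S := by
  rw [det3_eq, det3_eq]; simp only [Pi.smul_apply, smul_eq_mul]; ring

/-- Swapping the frame changes the sign of the determinant. -/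
theorem det3_swap (d A B : Fin 3 → ℝ) : det3 d B A = -det3 d A B := by
  rw [det3_eq, det3_eq]; ring

/-- Shearing the frame preserves the determinant. -/
theorem det3_add_smul (d A B : Fin 3 → ℝ) (r : ℝ) : det3 d (A + r • B) B = det3 d A B := by
  rw [det3_eq, det3_eq]; simp only [Pi.add_apply, Pi.smul_apply, smul_eq_mul]; ring

/-- Every non-zero direction is completed to a frame by two coordinate vectors. -/
theorem exists_frame (d : Fin 3 → ℝ) (hd : d ≠ 0) : ∃ A B : Fin 3 → ℝ, det3 d A B ≠ 0 := by
  have h : d 0 ≠ 0 ∨ d 1 ≠ 0 ∨ d 2 ≠ 0 := by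
    by_contra h'
    push Not at h'
    apply hd; funext i; fin_cases i <;> simp [h']
  rcases h with h | h | h
  · refine ⟨![0, 1, 0], ![0, 0, 1], ?_⟩
    rw [det3_eq]; simp; exact h
  · refine ⟨![0, 0, 1], ![1, 0, 0], ?_⟩
    rw [det3_eq]; simp; exact h
  · refine ⟨![1, 0, 0], ![0, 1, 0], ?_⟩
    rw [det3_eq]; simp; exact h

/-- A unit sign is `±1`. -/
theorem eq_or_eq_neg_of_abs_eq_one {o : ℝ} (ho : |o| = 1) : o = 1 ∨ o = -1 := by
  rcases abs_eq (zero_le_one' ℝ) |>.1 ho with h | h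
  · exact Or.inl h
  · exact Or.inr h

/-- **From eventual finiteness of all signed sectors to a cone of directions.** -/
theorem cone_of_eventually (ν : Measure (Fin 3 → ℝ)) (z₁ d A B : Fin 3 → ℝ)
    (hline : ν (dline z₁ d) = 0)
    (hV : ∀ p q : ℝ, |p| = 1 → |q| = 1 → ∀ᶠ δt in 𝓝[>] (0 : ℝ), ∀ᶠ δ in 𝓝[>] (0 : ℝ),
      ∀ᶠ ε in 𝓝[>] (0 : ℝ), ν (nsector z₁ d (p • B) (q • A) δt δ (Ico 0 ε)) < ∞)
    (hS : ∀ r o σ : ℝ, |o| = 1 → |σ| = 1 → ∀ᶠ δt in 𝓝[>] (0 : ℝ), ∀ᶠ δ in 𝓝[>] (0 : ℝ),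
      ∀ᶠ ε in 𝓝[>] (0 : ℝ), ν (nsector z₁ d (o • (A + r • B)) (σ • B) δt δ (Ico 0 ε)) < ∞) :
    ∃ δ' > 0, ∃ δt > 0, ν (dcone z₁ d A B δt δ') < ∞ := by
  have h1 : |(1 : ℝ)| = 1 := abs_one
  have hm1 : |(-1 : ℝ)| = 1 := by simp
  obtain ⟨δtV, hδtV, δV, hδV, εV, hεV, v11, v12, v21, v22⟩ := exists_of_eventually₄3
    (hV 1 1 h1 h1) (hV 1 (-1) h1 hm1) (hV (-1) 1 hm1 h1) (hV (-1) (-1) hm1 hm1)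
  refine cone_finite ν z₁ d A B hline hδtV hδV hεV ?_ ?_
  · intro p q hp hq
    rcases eq_or_eq_neg_of_abs_eq_one hp with rfl | rfl <;>
      rcases eq_or_eq_neg_of_abs_eq_one hq with rfl | rfl <;> assumption
  · intro r
    obtain ⟨δt, hδt, δ, hδ, ε, hε, s11, s12, s21, s22⟩ := exists_of_eventually₄3
      (hS r 1 1 h1 h1) (hS r 1 (-1) h1 hm1) (hS r (-1) 1 hm1 h1) (hS r (-1) (-1) hm1 hm1)
    refine ⟨δt, hδt, 1, one_pos, δ, hδ, ε, hε, fun o σ ho hσ => ?_⟩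
    rw [mul_one]
    rcases eq_or_eq_neg_of_abs_eq_one ho with rfl | rfl <;>
      rcases eq_or_eq_neg_of_abs_eq_one hσ with rfl | rfl <;> assumption

/-- The graded form with zero coefficients vanishes. -/
theorem Fnum_zero {D : ℕ} (l₁ l₂ : ℝ) (ξ : Fin 3 → ℝ) : Fnum l₁ l₂ (0 : Coef₃ D) ξ = 0 := by
  unfold Fnum Fpc nterm; simp

/-! ### The local theorem -/

/-- **Local finiteness at every point of the closure of the base polyhedron.** -/
theorem local_finite3 {k mL m'' : ℕ} (φ : Fin m'' → (Fin 3 → ℝ) × ℝ)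
    (lo hi : Fin k → Fin k ⊕ Atm 3) (a : Fin k → Option (Atm 3))
    (κ : Fin mL → Fin 2 → ℝ) (μ : Fin mL → ℝ) (e : Fin mL → ℕ) (n : ℕ) (l₁ l₂ l₀ : ℝ)
    (N : ℕ) (q : ℕ → MvPolynomial (Fin 2) ℝ) (R : (Fin 3 → ℝ) → ℝ) (Ri : ℕ → (Fin 3 → ℝ) → ℝ)
    (hR : ∀ x, R x = (∑ i ∈ Finset.range N, MvPolynomial.eval (pr2 x) (q i) * lam3 l₁ l₂ l₀ x ^ i) /
      common κ μ e n l₁ l₂ l₀ x)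
    (hRi : ∀ i < N, ∀ x, Ri i x = MvPolynomial.eval (pr2 x) (q i) * lam3 l₁ l₂ l₀ x ^ i /
      common κ μ e n l₁ l₂ l₀ x)
    (hRm : Measurable R) (hRim : ∀ i, Measurable (Ri i))
    (hfinY : ∫⁻ x in {x | ∀ j, 0 < rav x (φ j)}, ENNReal.ofReal |R x| * lmass lo hi a (av x) < ∞)
    (hκ0 : ∀ j, e j ≠ 0 → κ j = 0 → μ j ≠ 0)
    (hH : ∀ j, e j ≠ 0 → ∀ x ∈ closure {x : Fin 3 → ℝ | ∀ j, 0 < rav x (φ j)},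
      lval3 κ μ j x = 0 → n ≠ 0 ∧ lam3 l₁ l₂ l₀ x = 0)
    (hnz : ∃ x₀ : Fin 3 → ℝ, (∑ i ∈ Finset.range N, MvPolynomial.eval (pr2 x₀) (q i) *
      lam3 l₁ l₂ l₀ x₀ ^ i) ≠ 0)
    (z₁ : Fin 3 → ℝ) (hz₁ : z₁ ∈ closure {x : Fin 3 → ℝ | ∀ j, 0 < rav x (φ j)}) :
    ∃ V : Set (Fin 3 → ℝ), IsOpen V ∧ z₁ ∈ V ∧
      ∫⁻ x in V, {x : Fin 3 → ℝ | ∀ j, 0 < rav x (φ j)}.indicator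
        (fun x => (∑ i ∈ Finset.range N, ENNReal.ofReal |Ri i x|) * lmass lo hi a (av x)) x < ∞ := by
  set Y : Set (Fin 3 → ℝ) := {x | ∀ j, 0 < rav x (φ j)} with hY
  have hYm : MeasurableSet Y := measurableSet_Y3 φ
  have hm : Measurable fun x : Fin 3 → ℝ => lmass lo hi a (av x) := measurable_lmass_av lo hi a
  set gg : (Fin 3 → ℝ) → ℝ≥0∞ := fun x => Y.indicator
    (fun x => (∑ i ∈ Finset.range N, ENNReal.ofReal |Ri i x|) * lmass lo hi a (av x)) x with hgg
  have hgm : Measurable gg := measurable_g3 N hYm hm hRim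
  set ν : Measure (Fin 3 → ℝ) := volume.withDensity gg with hν
  have hνS : ∀ s : Set (Fin 3 → ℝ), MeasurableSet s → ν s = ∫⁻ x in s, gg x := fun s hs =>
    withDensity_apply gg hs
  have hline : ∀ d, ν (dline z₁ d) = 0 := fun d =>
    withDensity_absolutelyContinuous _ _ (volume_dline z₁ d)
  have hν0 : ν {z₁} = 0 := by
    refine measure_mono_null (fun x hx => ?_) (hline 0)
    exact ⟨0, by rw [mem_singleton_iff.1 hx]; simp⟩
  -- sector finiteness for `ν` from the sector theorems
  have key : ∀ (d Q S : Fin 3 → ℝ), det3 d Q S ≠ 0 →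
      (∀ᶠ δt in 𝓝[>] (0 : ℝ), ∀ᶠ δ in 𝓝[>] (0 : ℝ), ∀ᶠ ε in 𝓝[>] (0 : ℝ),
        ∫⁻ z in nsector z₁ d Q S δt δ (Ico 0 ε), gg z < ∞) →
      ∀ᶠ δt in 𝓝[>] (0 : ℝ), ∀ᶠ δ in 𝓝[>] (0 : ℝ), ∀ᶠ ε in 𝓝[>] (0 : ℝ),
        ν (nsector z₁ d Q S δt δ (Ico 0 ε)) < ∞ := by
    intro d Q S hdet h
    refine h.mono fun δt h1 => h1.mono fun δ h2 => h2.mono fun ε h3 => ?_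
    rwa [hνS _ (measurableSet_nsector z₁ d Q S hdet δt δ measurableSet_Ico)]
  -- reduction to cones of directions
  suffices hcone : ∀ d : Fin 3 → ℝ, ‖d‖ = 1 → ∃ A B : Fin 3 → ℝ, det3 d A B ≠ 0 ∧
      ∃ δ' > 0, ∃ δt > 0, ν (dcone z₁ d A B δt δ') < ∞ by
    obtain ⟨V, hV, hzV, hfin⟩ := nhds_finite ν z₁ hν0 hcone
    exact ⟨V, hV, hzV, by rwa [hνS V hV.measurableSet] at hfin⟩
  intro d hd1
  have hd0 : d ≠ 0 := by rintro rfl; simp at hd1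
  obtain ⟨x₀, hx₀⟩ := hnz
  -- non-vanishing of graded data at `z₁`
  have hcne : ∀ {D : ℕ} (c : Coef₃ D), (∀ ξ : Fin 3 → ℝ, (∑ i ∈ Finset.range N,
      MvPolynomial.eval (pr2 (z₁ + ξ)) (q i) * lam3 l₁ l₂ l₀ (z₁ + ξ) ^ i) = Fnum l₁ l₂ c ξ) → c ≠ 0 := by
    intro D c hF hc
    apply hx₀
    have h := hF (x₀ - z₁)
    rwa [add_sub_cancel, hc, Fnum_zero] at h
  by_cases hreg : common κ μ e n l₁ l₂ l₀ z₁ ≠ 0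
  · -- regular point: every frame
    obtain ⟨D, c, hF⟩ := exists_data_any N q l₁ l₂ l₀ z₁
    have hc := hcne c hF
    have hall : ∀ Q S : Fin 3 → ℝ, det3 d Q S ≠ 0 → ∀ᶠ δt in 𝓝[>] (0 : ℝ), ∀ᶠ δ in 𝓝[>] (0 : ℝ),
        ∀ᶠ ε in 𝓝[>] (0 : ℝ), ν (nsector z₁ d Q S δt δ (Ico 0 ε)) < ∞ := fun Q S hdet =>
      key d Q S hdet (sector_away φ lo hi a κ μ e n l₁ l₂ l₀ N q R Ri z₁ hR hRi hRm hRim hfinY c hc hF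
        d Q S hdet hreg)
    obtain ⟨A, B, hAB⟩ := exists_frame d hd0
    refine ⟨A, B, hAB, cone_of_eventually ν z₁ d A B (hline d) (fun p q hp hq => hall _ _ ?_)
      (fun r o σ ho hσ => hall _ _ ?_)⟩
    · rw [det3_smul_smul, det3_swap]
      exact mul_ne_zero (mul_ne_zero (by rintro rfl; simp at hp) (by rintro rfl; simp at hq))
        (neg_ne_zero.2 hAB)
    · rw [show o • (A + r • B) = o • (A + r • B) from rfl, show σ • B = σ • B from rfl,
        det3_smul_smul, det3_add_smul]
      exact mul_ne_zero (mul_ne_zero (by rintro rfl; simp at ho) (by rintro rfl; simp at hσ)) hAB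
  -- a wall through `z₁`: by the wall invariant `z₁` is a pole point
  push Not at hreg
  have hpole : n ≠ 0 ∧ lam3 l₁ l₂ l₀ z₁ = 0 := by
    unfold common at hreg
    rcases mul_eq_zero.1 hreg with h | h
    · obtain ⟨j, -, hj⟩ := Finset.prod_eq_zero_iff.1 h
      have hej : e j ≠ 0 := by rintro h0; rw [h0, pow_zero] at hj; exact one_ne_zero hj
      exact hH j hej z₁ hz₁ (pow_eq_zero_iff hej |>.1 hj)
    · have hn : n ≠ 0 := by rintro h0; rw [h0, pow_zero] at h; exact one_ne_zero h
      exact ⟨hn, pow_eq_zero_iff hn |>.1 h⟩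
  obtain ⟨-, hlam⟩ := hpole
  by_cases hdP : lamL l₁ l₂ d = 0
  · -- type (III): direction in the pole plane, adapted frame plane
    set cw : Fin 2 → ℝ := ![-(d 1), d 0] with hcw
    have hd01 : d 0 ≠ 0 ∨ d 1 ≠ 0 := by
      by_contra h
      push Not at h
      apply hd0
      have h2 : d 2 = 0 := by rw [lamL] at hdP; rw [h.1, h.2] at hdP; linarith
      funext i; fin_cases i
      · exact h.1
      · exact h.2
      · exact h2
    have hsq : 0 < d 0 * d 0 + d 1 * d 1 := by
      rcases hd01 with h | h
      · have := mul_self_pos.2 h; nlinarith [mul_self_nonneg (d 1)]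
      · have := mul_self_pos.2 h; nlinarith [mul_self_nonneg (d 0)]
    have hdc : d 0 * cw 1 - d 1 * cw 0 ≠ 0 := by
      simp only [hcw, Matrix.cons_val_zero, Matrix.cons_val_one]
      nlinarith
    obtain ⟨D', hND', β, hβ, hβ0⟩ := exists_data_adapted N q (pr2 z₁) (pr2 d) cw
    have hκ' : ∀ j ∈ thr κ μ e z₁, klin κ j d ≠ 0 ∨ κ j 0 * cw 0 + κ j 1 * cw 1 ≠ 0 := by
      intro j hj
      have hej : e j ≠ 0 := (Finset.mem_filter.1 hj).2.2
      by_contra h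
      push Not at h
      obtain ⟨h1, h2⟩ := h
      simp only [klin] at h1
      simp only [hcw, Matrix.cons_val_zero, Matrix.cons_val_one] at h2
      have hk0 : κ j 0 * (d 0 * d 0 + d 1 * d 1) = 0 := by linear_combination (d 0) * h1 - (d 1) * h2
      have hk1 : κ j 1 * (d 0 * d 0 + d 1 * d 1) = 0 := by linear_combination (d 1) * h1 + (d 0) * h2
      have h0 : κ j 0 = 0 := by
        rcases mul_eq_zero.1 hk0 with h | h
        · exact h
        · linarith
      have h1' : κ j 1 = 0 := by
        rcases mul_eq_zero.1 hk1 with h | h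
        · exact h
        · linarith
      have hκj : κ j = 0 := by
        funext i; fin_cases i
        · exact h0
        · exact h1'
      have hL0 : lval3 κ μ j z₁ = 0 := (Finset.mem_filter.1 hj).2.1
      rw [lval3, h0, h1'] at hL0
      exact hκ0 j hej hκj (by linarith)
    set A : Fin 3 → ℝ := cvec l₁ l₂ cw with hA
    set B : Fin 3 → ℝ := Evec with hB
    have hfrm : ∀ Qy Qc : ℝ, Qy • B + Qc • A = frameIII l₁ l₂ cw Qy Qc := fun Qy Qc => rfl
    have hdetAB : det3 d A B ≠ 0 := by
      have h := det3_frameIII l₁ l₂ d hdP cw 0 1 1 0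
      have hA' : frameIII l₁ l₂ cw 0 1 = A := by rw [← hfrm]; simp
      have hB' : frameIII l₁ l₂ cw 1 0 = B := by rw [← hfrm]; simp
      rw [hA', hB'] at h
      rw [h]; simpa using hdc
    refine ⟨A, B, hdetAB, cone_of_eventually ν z₁ d A B (hline d) ?_ ?_⟩
    · -- vertical frames
      intro p q' hp hq
      have hp0 : p ≠ 0 := by rintro rfl; simp at hp
      have hq0 : q' ≠ 0 := by rintro rfl; simp at hq
      have hQ : p • B = frameIII l₁ l₂ cw p 0 := by rw [← hfrm]; simp
      have hS : q' • A = frameIII l₁ l₂ cw 0 q' := by rw [← hfrm]; simp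
      have hdet : det3 d (p • B) (q' • A) ≠ 0 := by
        rw [det3_smul_smul, det3_swap]
        exact mul_ne_zero (mul_ne_zero hp0 hq0) (neg_ne_zero.2 hdetAB)
      refine key d _ _ hdet ?_
      rw [hQ, hS]
      exact sector_IIIvert φ lo hi a κ μ e n l₁ l₂ l₀ N q R Ri z₁ hR hRi hRm hRim hfinY hlam d hdP cw
        hdc hND' β hβ hβ0 p q' hp0 hq0 hκ'
    · -- slope frames
      intro r o σ ho hσ
      have ho0 : o ≠ 0 := by rintro rfl; simp at ho
      have hσ0 : σ ≠ 0 := by rintro rfl; simp at hσ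
      have hS : σ • B = frameIII l₁ l₂ cw σ 0 := by rw [← hfrm]; simp
      have hdet : det3 d (o • (A + r • B)) (σ • B) ≠ 0 := by
        rw [det3_smul_smul, det3_add_smul]
        exact mul_ne_zero (mul_ne_zero ho0 hσ0) hdetAB
      refine key d _ _ hdet ?_
      by_cases hr : r = 0
      · have hQ : o • (A + r • B) = frameIII l₁ l₂ cw 0 o := by
          rw [← hfrm, hr]; simp
        rw [hQ, hS]
        exact sector_IIIzero φ lo hi a κ μ e n l₁ l₂ l₀ N q R Ri z₁ hR hRi hRm hRim hfinY hlam d hdP cw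
          hdc hND' β hβ hβ0 o σ ho0 hσ0 hκ'
      · have hQ : o • (A + r • B) = frameIII l₁ l₂ cw (o * r) o := by
          rw [← hfrm, smul_add, smul_smul, add_comm]
        rw [hQ, hS]
        exact sector_IIIgen φ lo hi a κ μ e n l₁ l₂ l₀ N q R Ri z₁ hR hRi hRm hRim hfinY hlam d hdP cw
          hdc hND' β hβ hβ0 (o * r) o σ 0 (by simpa using mul_ne_zero ho0 hσ0) (mul_ne_zero ho0 hr)
          ho0 hκ'
  · -- direction transversal to the pole plane: every frame
    obtain ⟨A, B, hAB⟩ := exists_frame d hd0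
    have hall : ∀ Q S : Fin 3 → ℝ, det3 d Q S ≠ 0 → ∀ᶠ δt in 𝓝[>] (0 : ℝ), ∀ᶠ δ in 𝓝[>] (0 : ℝ),
        ∀ᶠ ε in 𝓝[>] (0 : ℝ), ν (nsector z₁ d Q S δt δ (Ico 0 ε)) < ∞ := by
      intro Q S hdet
      refine key d Q S hdet ?_
      by_cases hII : ∃ j ∈ thr κ μ e z₁, klin κ j d = 0
      · -- type (II): null sectors by the wall invariant
        obtain ⟨j₀, hj₀, hjd⟩ := hII
        exact sector_null φ lo hi a κ μ e l₁ l₂ l₀ N Ri hRim z₁ (fun j hj x hx h => (hH j hj x hx h).2)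
          hlam d Q S hdet hdP j₀ hj₀ hjd
      · -- type (I)
        push Not at hII
        obtain ⟨D, hND, c, hF, hFi, -⟩ := exists_data_pole N q l₁ l₂ l₀ z₁ hlam
        have hc := hcne c hF
        have hω0 : (fun p : ℝ × ℝ × ℝ => omega3 κ μ e n l₁ l₂ z₁ d Q S p.1 p.2.1 p.2.2) 0 ≠ 0 := by
          simp only [Prod.fst_zero, Prod.snd_zero]
          exact omega3_corner_ne_zero κ μ e n l₁ l₂ z₁ d Q S (Or.inr (Or.inl hdP))
            fun j hj => Or.inl (hII j hj)
        obtain ⟨ωlo, hωlo, ωhi, ρ, hρ, hωb⟩ :=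
          exists_corner_bounds _ (continuous_omega3 κ μ e n l₁ l₂ z₁ d Q S) hω0
        have hDv : Dv3 κ μ e n l₁ l₂ z₁ d = 0 := Dv3_eq_zero κ μ e n l₁ l₂ z₁ d (Or.inr hdP) hII
        have hDu : Du3 κ μ e n l₁ l₂ z₁ d Q = 0 :=
          Du3_eq_zero κ μ e n l₁ l₂ z₁ d Q (Or.inr (Or.inl hdP)) fun j hj => Or.inl (hII j hj)
        exact sector_typeI φ lo hi a κ μ e n l₁ l₂ l₀ N q R Ri z₁ hR hRi hRm hRim hfinY hND c hc hF hFi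
          d Q S hdet (Dt3 κ μ e n z₁) (omega3 κ μ e n l₁ l₂ z₁ d Q S)
          (continuous_omega3 κ μ e n l₁ l₂ z₁ d Q S).measurable
          (fun t v u ht hv hu => by
            rw [abs_common_npt κ μ e n l₁ l₂ l₀ z₁ d Q S hlam ht hv hu, hDv, hDu, pow_zero, pow_zero,
              mul_one, mul_one])
          hωlo hρ hωb
    refine ⟨A, B, hAB, cone_of_eventually ν z₁ d A B (hline d) (fun p q hp hq => hall _ _ ?_)
      (fun r o σ ho hσ => hall _ _ ?_)⟩
    · rw [det3_smul_smul, det3_swap]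
      exact mul_ne_zero (mul_ne_zero (by rintro rfl; simp at hp) (by rintro rfl; simp at hq))
        (neg_ne_zero.2 hAB)
    · rw [det3_smul_smul, det3_add_smul]
      exact mul_ne_zero (mul_ne_zero (by rintro rfl; simp at ho) (by rintro rfl; simp at hσ)) hAB

end SepHHK

/-- **Local finiteness of the density of the Taylor pieces** (registered part of
`stub_separateHigh`, base dimension `3` with fibres; literal form of `SepHHK.local_finite3`):
under the wall invariant `hH`, every point of the closure of the base polyhedron has an open
neighbourhood on which `𝟙_Y (∑_{i<N} |Ri i|) · m` has finite integral. -/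
theorem separateThreeHHK_local (k mL m'' : ℕ) (φ : Fin m'' → (Fin 3 → ℝ) × ℝ) (lo hi : Fin k → Fin k ⊕ ((Fin 3 → ℚ) × ℚ)) (a : Fin k → Option ((Fin 3 → ℚ) × ℚ)) (κ : Fin mL → Fin 2 → ℝ) (μ : Fin mL → ℝ) (e : Fin mL → ℕ) (n : ℕ) (l₁ l₂ l₀ : ℝ) (N : ℕ) (q : ℕ → MvPolynomial (Fin 2) ℝ) (R : (Fin 3 → ℝ) → ℝ) (Ri : ℕ → (Fin 3 → ℝ) → ℝ) (hR : ∀ x, R x = (∑ i ∈ Finset.range N, MvPolynomial.eval (SepHHK.pr2 x) (q i) * SepHHK.lam3 l₁ l₂ l₀ x ^ i) / SepHHK.common κ μ e n l₁ l₂ l₀ x) (hRi : ∀ i < N, ∀ x, Ri i x = MvPolynomial.eval (SepHHK.pr2 x) (q i) * SepHHK.lam3 l₁ l₂ l₀ x ^ i / SepHHK.common κ μ e n l₁ l₂ l₀ x) (hRm : Measurable R) (hRim : ∀ i, Measurable (Ri i)) (hfinY : MeasureTheory.lintegral (MeasureTheory.volume.restrict {x | ∀ j, 0 < SepHHK.rav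 x (φ j)}) (fun x => ENNReal.ofReal |R x| * SepTwo.lmass lo hi a (SepTwo.av x)) < ⊤) (hκ0 : ∀ j, e j ≠ 0 → κ j = 0 → μ j ≠ 0) (hH : ∀ j, e j ≠ 0 → ∀ x ∈ closure {x : Fin 3 → ℝ | ∀ j, 0 < SepHHK.rav x (φ j)}, SepHHK.lval3 κ μ j x = 0 → n ≠ 0 ∧ SepHHK.lam3 l₁ l₂ l₀ x = 0) (hnz : ∃ x₀ : Fin 3 → ℝ, (∑ i ∈ Finset.range N, MvPolynomial.eval (SepHHK.pr2 x₀) (q i) * SepHHK.lam3 l₁ l₂ l₀ x₀ ^ i) ≠ 0) (z₁ : Fin 3 → ℝ) (hz₁ : z₁ ∈ closure {x : Fin 3 → ℝ | ∀ j, 0 < SepHHK.rav x (φ j)}) : ∃ V : Set (Fin 3 → ℝ), IsOpen V ∧ z₁ ∈ V ∧ MeasureTheory.lintegral (MeasureTheory.volume.restrict V) (fun x => {x : Fin 3 → ℝ | ∀ j, 0 < SepHHK.rav x (φ j)}.indicator (fun x => (∑ i ∈ Finset.range N, ENNReal.ofReal |Ri i x|) * SepTwo.lmass lo hi a (SepTwo.av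 x)) x) < ⊤ := by
  exact SepHHK.local_finite3 φ lo hi a κ μ e n l₁ l₂ l₀ N q R Ri hR hRi hRm hRim hfinY hκ0 hH hnz z₁ hz₁

end Summit.KontsevichZagierPeriods.ArrangementNormalForm.JanusBands
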